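import Literature.IUT.LogThetaLattice.PacketLogVolumesHaarModelCapsulesGeneral
import Literature.IUT.LogThetaLattice.PacketLogVolumesHaarModelRelLocal
import Literature.IUT.LogVolume.CompletionLocalFields
import HarnessLib

/-!
# [IUTchIII] Proposition 3.9 (i)/(iii) for CAPSULES at the RELATIVE genuine model: the portions
# `⊗_{α∈A} K_{v̲_α}` of the `A`-packets of `K ⊋ F_mod` at a section of places, Remark 3.1.1 (ii)'s normalized
# weights with the factors `[K_{v̲_α} : (F_mod)_{v_α}]`, and the invariance of `μ^log_{A,𝕍_ℚ}` under `F_mod^×`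
# on every label (abc-iut cell, layer L6; row REL39, part R3 = REL39-B of L6-lead §F v1.19c)

S. Mochizuki, *Inter-universal Teichmüller theory III*, kurims manuscript (May 2020), §3 [claim: Mochizuki2012,
status: disputed]. Proposition 3.1, p. 92/93: "`log(^A𝓕_{v_ℚ}) := ⊗_{α∈A} log(^α𝓕_{v_ℚ})`"; Remark 3.1.1 (ii),
p. 94: "when we consider log-volumes on the portion of `log(^A𝓕_{v_ℚ})` corresponding to the tensor product of
various `K_{v_α}`, where `𝕍 ∋ v_α | v_ℚ`, it will be necessary to consider these log-volumes relative to the weight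
`1/∏_{α∈A}[K_{v_α}:(F_mod)_{v_α}]` … the normalized weight
`1/((∏_{α∈A}[K_{v_α}:(F_mod)_{v_α}])·{Σ_{{w_α}_{α∈A}} ∏_{α∈A}[(F_mod)_{w_α}:ℚ_{v_ℚ}]})`"; Proposition 3.9 (i)
p. 115 ("log-volumes `μ^log_{A,v_ℚ}`"), (iii) p. 117 ("a global log-volume `μ^log_{A,𝕍_ℚ}` … invariant with respect
to multiplication by elements of `(†𝕄⊛_mod)_α = (†𝕄⊛_MOD)_α`"); [IUTchI] Def. 3.1 (e) p. 62 ("`V̲ ⊆ V(K)` … a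
section of the natural surjection `V(K) ↠ V_mod`").

WHAT THIS FILE ADDS. abc-iut-L6-d3's `PacketLogVolumesHaarModelCapsulePortions/…CapsulesGeneral` (p418604/p419250)
are the genuine `A`-packets in the case `K = F_mod = F` (portions `⊗_α F_{v_α}`, `[K_v:(F_mod)_v] = 1`). Here
`K ⊇ F` is ANY extension of number fields (`F` in the role of `F_mod`), the places of `K` are chosen by a section
`v ↦ v̲` (campaign-S `PlaceSection F K` at the finite places; at the archimedean places an arbitrary lift
`τ : 𝕍(F)^arc → 𝕍(K)^arc` with `τ(w)|_F = w`, unbundled so that any section structure of parts R1-arch/R2 of the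
row instantiates it by projection), and the portion of the `A`-packet at `v_ℚ` indexed by the tuple
`π = (v_α)_{α∈A}` of places of `F_mod` over `v_ℚ` is print's `⊗_{α} K_{v̲_α}`:
* `CapsuleDatum.comap` — a portion of the `A`-packet of `K`, with `f ∈ F` acting on a label through `F → K`
  (the companion of abc-iut-L6-t5's `PlaceHaarDatum.comap`, p421193);
* **`relPortionDatum σ τ A q π`** — d3's GENUINE portion of `K` at the lifted tuple, pulled back to `F`: at
  `v_ℚ = p` the real tensor packet `⊗_{α,ℚ_p} K_{v̲_α}` (Haar log-volume normalised by the dimension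
  `∏_α [K_{v̲_α}:ℚ_p]`), at `v_ℚ = ∞` the packet `⊗_{α,ℝ} ℂ = ⊗_α K_{w̲_α}`;
* **`relPortionDatum_shift`**: the shift of the relative portion under `f ∈ F^×` on the label `α` EQUALS the
  absolute one, `θ_{v_α}(f) = (1/n_{v_α})·log‖f‖_{v_α}` resp. `log|f|_{w_α}` — at finite places by t5's
  `log‖f‖_{K_{v̲}} = [K_{v̲}:F_v]·log‖f‖_v` and the tower law **`localDegree_lift_eq_mul`:
  `[K_{v̲}:ℚ_p] = [K_{v̲}:F_v]·[F_v:ℚ_p]`** (read off the same identity at `f = p`), at archimedean places by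
  `|f|_{w̲} = |f|_w`;
* **`portionWeight_prime_eq_packetWeightTensor_rel_mul`** — the JUNCTION WITH THE PRINTED WEIGHT for general `K`:
  d3's dimension-normalised portion weight `∏_α n_{v_α}/[F:ℚ]` equals abc-iut-L6-t4's `packetWeightTensor` at
  `degF = [(F_mod)_w:ℚ_p]` and **`degKF(v) = [K_{v̲}:(F_mod)_v]`** (the verbatim normalized weight of Rmk. 3.1.1 (ii),
  now with non-trivial relative degrees) times the dimension `∏_α [K_{v̲_α}:ℚ_p]` that the normalised `μ^log`
  divides by — the factors `[K_{v̲_α}:(F_mod)_{v_α}]` cancel exactly as print says they are there to;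
* `relCapsulePacketLogVolume σ τ A` = `μ^log_{A,v_ℚ}` on genuine regions (families over the portions of admissible
  subsets of `⊗_α K_{v̲_α}`), `relCapsulePacketAction σ τ A α` = `f ∈ F^×` on the label `α`, and
  **`prop39iii_invariance_haarModelRelCapsules σ τ A α : Prop39iii_invariance (relCapsulePacketLogVolume σ τ A)
  (relCapsulePacketAction σ τ A α)`** — the printed invariance clause HOLDS at the relative genuine `A`-packets for
  every `A`, every label, every `K ⊇ F`, every section (reduction to d3's `capsulePacketLogModulus` and the product
  formula for `F`); the nonarchimedean packet-normalisation `μ^log_{A,p}(p·_α T) = μ^log_{A,p}(T) − log p`.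

HONEST SCOPE. (1) The archimedean portion is `⊗_ℝ` of copies of `ℂ` (d3's `archPortion` for `K`) — faithful for
the totally complex `K` of [IUTchI] Def. 3.1 (b). (2) Regions are ALL subsets of positive finite volume (a superset
of print's `𝕄(−)`). (3) Log-volumes are campaign S's dimension-normalised ones; the junction theorem records the
bookkeeping against the printed (un-normalised) convention. (4) The DEGREE clause of (iii) at this model is a
separate file of this part. Nothing here constructs `(†𝓕⊛_mod)_α`, asserts anything about [IUTchIII] Cor. 3.12, or
takes a side; typed ≠ endorsed. Classical mathematics (Haar measure on `⊗ K_i`, `[L_w:K_v] = e f`, the product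
formula). [cite: NeukirchANT1999, Ch. II Prop. (8.5)] [cite: DupuyHilado2025, §3.7]
-/

noncomputable section

namespace Literature.IUT.LogThetaLattice

open Literature.IUT.LogVolume Literature.NumberTheory.NumberFields NumberField IsDedekindDomain MeasureTheory Set
open scoped ENNReal NNReal

/-! ### Pulling a portion of the `A`-packet of `K` back to `F` along `F → K` -/

namespace CapsuleDatum

variable {F K : Type} [Field F] [Field K] {A : Type}

/-- A portion of the `A`-packet of `K`, viewed as a datum for `F`: same carrier, regions and log-volume; `f ∈ F^×`
acts on the label `α` (and is measured) through `φ : F → K` (print: `(†𝕄⊛_mod)_α` acts on the packets of `K`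
through `F_mod ⊆ K`). [claim: Mochizuki2012, status: disputed] -/
def comap (D : CapsuleDatum K A) (φ : F →+* K) : CapsuleDatum F A where
  X := D.X
  IsAdm := D.IsAdm
  logVol := D.logVol
  act α f T := D.act α (Units.map (φ : F →* K) f) T
  shift α f := D.shift α (Units.map (φ : F →* K) f)
  isAdm_act α f T hT := D.isAdm_act α (Units.map (φ : F →* K) f) T hT
  logVol_act α f T hT := D.logVol_act α (Units.map (φ : F →* K) f) T hT

/-- The shift of the pulled-back portion is the shift under `φ f`. [claim: Mochizuki2012, status: disputed] -/
@[simp] theorem comap_shift (D : CapsuleDatum K A) (φ : F →+* K) (α : A) (f : Fˣ) :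
    (D.comap φ).shift α f = D.shift α (Units.map (φ : F →* K) f) := rfl

/-- The log-volume of the pulled-back portion is unchanged. [claim: Mochizuki2012, status: disputed] -/
theorem comap_logVol (D : CapsuleDatum K A) (φ : F →+* K) (T : Set D.X) : (D.comap φ).logVol T = D.logVol T := rfl

end CapsuleDatum

variable {F K : Type} [Field F] [NumberField F] [Field K] [NumberField K] [Algebra F K]
  (σ : PlaceSection F K) (τ : InfinitePlace F → InfinitePlace K) (hτ : ∀ w, (τ w).comap (algebraMap F K) = w)
variable (A : Type) [Fintype A] [DecidableEq A] [Nonempty A]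

/-! ### The tower law for local degrees along the section -/

/-- **`[K_{v̲}:ℚ_p] = [K_{v̲}:F_v]·[F_v:ℚ_p]`** for `v | p` (local degrees `n = e·f`, campaign S's `localDegree`, and
abc-iut-L6-t5's `relLocalDegree = e(v̲|v)·f(v̲|v)`): read off t5's `log‖f‖_{K_{v̲}} = [K_{v̲}:F_v]·log‖f‖_v` at `f = p`
and `log‖p‖ = −n·log p` in both fields (d3's `log_adicAbv_natCast_prime`). [cite: NeukirchANT1999, Ch. II Prop. (8.5)] -/
theorem localDegree_lift_eq_mul (p : Nat.Primes) {v : HeightOneSpectrum (𝓞 F)} (hv : v ∈ placesOver F (p : ℕ)) :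
    localDegree K (σ.lift v) = relLocalDegree F K (Sum.inr (σ.lift v)) * localDegree F v := by
  haveI : Fact (p : ℕ).Prime := ⟨p.2⟩
  have hp0 : ((p : ℕ) : F) ≠ 0 := by exact_mod_cast p.2.ne_zero
  have hlog : Real.log p ≠ 0 :=
    Real.log_ne_zero_of_pos_of_ne_one (by exact_mod_cast p.2.pos) (by exact_mod_cast p.2.ne_one)
  have hfin : finBelow F K (σ.lift v) = v := σ.under_lift v
  have h := log_modulus_relPlaceDatum_inr F K (σ.lift v) hp0
  rw [relPlaceDatum_modulus_inr, placeDatum_inr, nonarchDatum_modulus, hfin, map_natCast,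
    log_adicAbv_natCast_prime K p (σ.lift_mem_placesOver ⟨v, hv⟩), log_adicAbv_natCast_prime F p hv] at h
  have h' : ((localDegree K (σ.lift v) : ℕ) : ℝ) =
      ((relLocalDegree F K (Sum.inr (σ.lift v)) * localDegree F v : ℕ) : ℝ) := by
    push_cast
    have := mul_right_cancel₀ hlog (by linarith : (localDegree K (σ.lift v) : ℝ) * Real.log p =
      (relLocalDegree F K (Sum.inr (σ.lift v)) : ℝ) * localDegree F v * Real.log p)
    linarith
  exact_mod_cast h'

/-! ### The relative portions `⊗_α K_{v̲_α}` -/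

/-- The lifted tuple: for a tuple `(v_α)_α` of places of `F` over `p`, the tuple `(v̲_α)_α` of places of `K` over `p`
(campaign-S `PlaceSection.lift_mem_placesOver`). [cite: Mochizuki2012, IUTchI Def. 3.1 (e) p. 62] -/
def liftTuple (p : Nat.Primes) [Fact (p : ℕ).Prime]
    (vA : A → {v : HeightOneSpectrum (𝓞 F) // v ∈ placesOver F (p : ℕ)}) :
    A → {w : HeightOneSpectrum (𝓞 K) // w ∈ placesOver K (p : ℕ)} :=
  fun α => ⟨σ.lift (vA α).1, σ.lift_mem_placesOver (vA α)⟩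

/-- **The portion of the `A`-packet of `K ⊇ F_mod` indexed by a tuple of places of `F_mod`** ([IUTchIII] Prop. 3.1 /
Rmk. 3.1.1 (ii) "the tensor product of various `K_{v_α}`, where `𝕍 ∋ v_α | v_ℚ`", `𝕍 = V̲ ≅ 𝕍_mod`): at `v_ℚ = p`,
abc-iut-L6-d3's genuine portion `⊗_{α,ℚ_p} K_{v̲_α}` of `K` at the lifted tuple; at `v_ℚ = ∞`, `⊗_{α,ℝ} ℂ =
⊗_α K_{τ(w_α)}`; in both cases `f ∈ F_mod` acting on a label through `F_mod → K` (`CapsuleDatum.comap`).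
[claim: Mochizuki2012, status: disputed] -/
def relPortionDatum : (q : RatPlace) → Portion F A q → CapsuleDatum F A
  | Sum.inl (), π => (archPortion K A (fun α => τ (packetInftyEquiv F (π α)))).comap (algebraMap F K)
  | Sum.inr p, π =>
      haveI : Fact (p : ℕ).Prime := ⟨p.2⟩
      (nonarchPortion K A p (liftTuple σ A p (fun α => packetPrimeEquiv F p (π α)))).comap (algebraMap F K)

/-- The relative portion datum at `∞` (definitional). [claim: Mochizuki2012, status: disputed] -/
theorem relPortionDatum_infty (π : Portion F A RatPlace.infty) :
    relPortionDatum σ τ A RatPlace.infty π =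
      (archPortion K A (fun α => τ (packetInftyEquiv F (π α)))).comap (algebraMap F K) := rfl

/-- The relative portion datum at `p` (definitional; any `Fact p.Prime` instance). [claim: Mochizuki2012, status: disputed] -/
theorem relPortionDatum_prime (p : Nat.Primes) [Fact (p : ℕ).Prime] (π : Portion F A (RatPlace.prime p)) :
    relPortionDatum σ τ A (RatPlace.prime p) π =
      (nonarchPortion K A p (liftTuple σ A p (fun α => packetPrimeEquiv F p (π α)))).comap (algebraMap F K) := rfl

/-- **The shift of the relative portion at `p` under `f` on the label `α` is the ABSOLUTE per-place log-modulus
`θ_{v_α}(f) = (1/n_{v_α})·log‖f‖_{v_α}`**: `(1/[K_{v̲}:ℚ_p])·log‖f‖_{K_{v̲}} = (1/([K_{v̲}:F_v]·n_v))·[K_{v̲}:F_v]·log‖f‖_v`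
(t5's `log_modulus_relPlaceDatum_inr`, `localDegree_lift_eq_mul`). [claim: Mochizuki2012, status: disputed] -/
theorem relPortionDatum_shift_prime (p : Nat.Primes) (π : Portion F A (RatPlace.prime p)) (α : A) (f : Fˣ) :
    (relPortionDatum σ τ A (RatPlace.prime p) π).shift α f = placeLogModulus F f (π α).1 := by
  haveI : Fact (p : ℕ).Prime := ⟨p.2⟩
  rw [relPortionDatum_prime, CapsuleDatum.comap_shift, nonarchPortion_shift]
  -- the place `v_α` of `F` over `p` and its lift
  rw [← portionDatum_shift F A (RatPlace.prime p) π α f, portionDatum_prime, nonarchPortion_shift]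
  set v := packetPrimeEquiv F p (π α) with hvdef
  have hfin : finBelow F K (σ.lift v.1) = v.1 := σ.under_lift v.1
  have hrel : (0 : ℝ) < relLocalDegree F K (Sum.inr (σ.lift v.1)) := by
    exact_mod_cast relLocalDegree_pos F K (Sum.inr (σ.lift v.1))
  have hn : (0 : ℝ) < localDegree F v.1 := by exact_mod_cast localDegree_pos F v.1
  have ha := log_modulus_relPlaceDatum_inr F K (σ.lift v.1) f.ne_zero
  rw [relPlaceDatum_modulus_inr, placeDatum_inr, nonarchDatum_modulus, hfin] at ha
  show Real.log (NumberField.HeightOneSpectrum.adicAbv K (σ.lift v.1) ((Units.map (algebraMap F K : F →* K) f : Kˣ) : K)) /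
      localDegree K (σ.lift v.1) = Real.log (NumberField.HeightOneSpectrum.adicAbv F v.1 (f : F)) / localDegree F v.1
  rw [Units.coe_map, MonoidHom.coe_coe, ha, localDegree_lift_eq_mul σ p v.2]
  push_cast
  field_simp

/-! ### Junction with the printed weight of Remark 3.1.1 (ii) for general `K ⊇ F_mod` -/

/-- The relative local degrees `[K_{v̲}:F_v]` over `p` as positive integers — the input `degKF = [K_v:(F_mod)_v]` of
abc-iut-L6-t4's `packetWeightTensor` (t5's `relLocalDegree` at `v̲`). [claim: Mochizuki2012, status: disputed] -/
def relLocalDegreePNat (p : Nat.Primes) (v : {v : HeightOneSpectrum (𝓞 F) // v ∈ placesOver F (p : ℕ)}) : ℕ+ :=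
  ⟨relLocalDegree F K (Sum.inr (σ.lift v.1)), relLocalDegree_pos F K _⟩

/-- `relLocalDegreePNat` is `[K_{v̲}:F_v]`. [claim: Mochizuki2012, status: disputed] -/
@[simp] theorem relLocalDegreePNat_coe (p : Nat.Primes) (v : {v : HeightOneSpectrum (𝓞 F) // v ∈ placesOver F (p : ℕ)}) :
    ((relLocalDegreePNat σ p v : ℕ) : ℝ) = relLocalDegree F K (Sum.inr (σ.lift v.1)) := rfl

omit [Nonempty A] in
/-- **d3's portion weight IS the printed normalized weight (general `K`) times the dimension of the portion**: for
`π = (v_α)_α` over `p`, `∏_α n_{v_α}/[F:ℚ] = packetWeightTensor(π)·∏_α [K_{v̲_α}:ℚ_p]` with abc-iut-L6-t4's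
`packetWeightTensor degF degKF π = 1/((∏_α degKF(v_α))·Σ_{(w_α)}∏_α degF(w_α))` at `degF = n` (`[(F_mod)_w:ℚ_p]`) and
`degKF(v) = [K_{v̲}:(F_mod)_v]` — Remark 3.1.1 (ii)'s third display VERBATIM, relative factors included: since
`Σ_{(w_α)}∏_α n_{w_α} = [F:ℚ]^{|A|}` and `[K_{v̲_α}:ℚ_p] = [K_{v̲_α}:F_{v_α}]·n_{v_α}` (`localDegree_lift_eq_mul`), the
factors `[K_{v̲_α}:F_{v_α}]` cancel. So `portionWeight × (dimension-normalised μ^log of ⊗_α K_{v̲_α})` is, portion by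
portion, the PRINTED weight times the PRINTED (un-normalised) log-volume. [claim: Mochizuki2012, status: disputed] -/
theorem portionWeight_prime_eq_packetWeightTensor_rel_mul (p : Nat.Primes) (π : Portion F A (RatPlace.prime p)) :
    portionWeight F A (RatPlace.prime p) π =
      packetWeightTensor (localDegreePNat F p) (relLocalDegreePNat σ p) (fun α => packetPrimeEquiv F p (π α)) *
        ∏ α, (localDegree K (σ.lift (packetPrimeEquiv F p (π α)).1) : ℝ) := by
  haveI : Fact (p : ℕ).Prime := ⟨p.2⟩
  have hd : (Module.finrank ℚ F : ℝ) ≠ 0 := (FinDivisor.finrank_pos (F := F)).ne'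
  have hS : (∑ w' : A → {v : HeightOneSpectrum (𝓞 F) // v ∈ placesOver F (p : ℕ)},
      ∏ a, ((localDegreePNat F p (w' a) : ℕ) : ℝ)) = (Module.finrank ℚ F : ℝ) ^ Fintype.card A := by
    rw [sum_prod_degF_eq_pow (localDegreePNat F p)]
    congr 1
    simp only [localDegreePNat_coe]
    rw [Finset.sum_coe_sort (placesOver F (p : ℕ)) (fun v => (localDegree F v : ℝ)), ← Nat.cast_sum,
      sum_localDegree F (p : ℕ)]
  have hfac : ∀ α, placeProbWeight F (π α).1 =
      (localDegree F (packetPrimeEquiv F p (π α)).1 : ℝ) / Module.finrank ℚ F := by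
    intro α
    generalize π α = v
    rcases v with ⟨w | w, h⟩
    · exact absurd h (ratPlaceBelow_inl_ne_prime F w p)
    · rfl
  have htower : ∀ α, (localDegree K (σ.lift (packetPrimeEquiv F p (π α)).1) : ℝ) =
      (relLocalDegreePNat σ p (packetPrimeEquiv F p (π α)) : ℕ) * (localDegree F (packetPrimeEquiv F p (π α)).1 : ℝ) := by
    intro α
    rw [localDegree_lift_eq_mul σ p (packetPrimeEquiv F p (π α)).2]
    push_cast
    rfl
  have hrel : ∀ α, ((relLocalDegreePNat σ p (packetPrimeEquiv F p (π α)) : ℕ) : ℝ) ≠ 0 :=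
    fun α => by exact_mod_cast (relLocalDegreePNat σ p (packetPrimeEquiv F p (π α))).ne_zero
  unfold portionWeight packetWeightTensor
  simp_rw [hfac, htower]
  rw [hS, Finset.prod_div_distrib, Finset.prod_const, Finset.card_univ, Finset.prod_mul_distrib]
  have hP : (∏ α, ((relLocalDegreePNat σ p (packetPrimeEquiv F p (π α)) : ℕ) : ℝ)) ≠ 0 :=
    Finset.prod_ne_zero_iff.mpr fun α _ => hrel α
  field_simp

/-! ### The relative capsule log-volume `μ^log_{A,v_ℚ}` and its change under `F_mod^×` on a label -/

/-- **[IUTchIII] Prop. 3.9 (i) datum `μ^log_{A,v_ℚ}` at the relative genuine model**: a region of the `A`-packet at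
`v_ℚ` is a family `T = (T_π)_π`, over the portions `π = (v_α)_α` (tuples of places of `F_mod` over `v_ℚ`), of
admissible subsets `T_π ⊆ ⊗_α K_{v̲_α}`, and `μ^log_{A,v_ℚ}(T) := Σ_π portionWeight(π)·μ^log_π(T_π)` (weights: see
`portionWeight_prime_eq_packetWeightTensor_rel_mul`). [claim: Mochizuki2012, status: disputed] -/
def relCapsulePacketLogVolume (q : RatPlace) (T : ∀ π : Portion F A q, (relPortionDatum σ τ A q π).Adm) : ℝ :=
  ∑ π : Portion F A q, portionWeight F A q π * (relPortionDatum σ τ A q π).logVol (T π).1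

/-- The change of `μ^log_{A,v_ℚ}` under `f ∈ F_mod^×` acting on the label `α`. [claim: Mochizuki2012, status: disputed] -/
def relCapsulePacketLogModulus (α : A) (f : Fˣ) (q : RatPlace) : ℝ :=
  ∑ π : Portion F A q, portionWeight F A q π * (relPortionDatum σ τ A q π).shift α f

/-- `μ^log_{A,v_ℚ}(f·_α T) = μ^log_{A,v_ℚ}(T) + relCapsulePacketLogModulus α f v_ℚ`. [claim: Mochizuki2012, status: disputed] -/
theorem relCapsulePacketLogVolume_actAdm (α : A) (f : Fˣ) (q : RatPlace)
    (T : ∀ π : Portion F A q, (relPortionDatum σ τ A q π).Adm) :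
    relCapsulePacketLogVolume σ τ A q (fun π => (relPortionDatum σ τ A q π).actAdm α f (T π)) =
      relCapsulePacketLogVolume σ τ A q T + relCapsulePacketLogModulus σ τ A α f q := by
  simp only [relCapsulePacketLogVolume, relCapsulePacketLogModulus, CapsuleDatum.logVol_actAdm, mul_add,
    Finset.sum_add_distrib]

include hτ

/-! ### With the archimedean lift a section (`τ(w)|_F = w`): the shifts agree with the absolute ones -/

/-- **The shift of the relative portion at `∞` under `f` on the label `α` is `log|f|_{w_α}`** (`|f|_{τ(w)} = |f|_w`,
Mathlib `InfinitePlace.comap_apply`). [claim: Mochizuki2012, status: disputed] -/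
theorem relPortionDatum_shift_infty (π : Portion F A RatPlace.infty) (α : A) (f : Fˣ) :
    (relPortionDatum σ τ A RatPlace.infty π).shift α f = placeLogModulus F f (π α).1 := by
  rw [← portionDatum_shift F A RatPlace.infty π α f, relPortionDatum_infty, CapsuleDatum.comap_shift,
    archPortion_shift, portionDatum_infty, archPortion_shift, Units.coe_map, MonoidHom.coe_coe,
    ← InfinitePlace.comap_apply, hτ]

/-- **The relative shift IS the absolute shift** at every `v_ℚ` and every portion: `shift^rel_π(α,f) = θ_{π(α)}(f)`.
[claim: Mochizuki2012, status: disputed] -/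
theorem relPortionDatum_shift (q : RatPlace) (π : Portion F A q) (α : A) (f : Fˣ) :
    (relPortionDatum σ τ A q π).shift α f = placeLogModulus F f (π α).1 := by
  rcases q with ⟨⟩ | p
  · exact relPortionDatum_shift_infty σ τ hτ A π α f
  · exact relPortionDatum_shift_prime σ τ A p π α f

/-- **The relative change IS d3's absolute change**: `relCapsulePacketLogModulus σ τ A α f = capsulePacketLogModulus F A α f`
(portion by portion the shifts agree, `relPortionDatum_shift`), hence `= packetLogModulus F f`, the `|A| = 1`,
`K = F` change of p415871. [claim: Mochizuki2012, status: disputed] -/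
theorem relCapsulePacketLogModulus_eq (α : A) (f : Fˣ) :
    relCapsulePacketLogModulus σ τ A α f = capsulePacketLogModulus F A α f := by
  funext q
  unfold relCapsulePacketLogModulus capsulePacketLogModulus
  exact Finset.sum_congr rfl fun π _ => by rw [relPortionDatum_shift σ τ hτ, portionDatum_shift]

/-- `relCapsulePacketLogModulus σ τ A α f q = Σ_{v|v_ℚ} c_v·log‖f‖_v`. [claim: Mochizuki2012, status: disputed] -/
theorem relCapsulePacketLogModulus_eq_packetLogModulus (α : A) (f : Fˣ) (q : RatPlace) :
    relCapsulePacketLogModulus σ τ A α f q = packetLogModulus F f q := by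
  rw [relCapsulePacketLogModulus_eq σ τ hτ, capsulePacketLogModulus_eq_packetLogModulus]

/-- The changes are finitely supported on `𝕍_ℚ` … [claim: Mochizuki2012, status: disputed] -/
theorem finite_support_relCapsulePacketLogModulus (α : A) (f : Fˣ) :
    (Function.support (relCapsulePacketLogModulus σ τ A α f)).Finite := by
  rw [relCapsulePacketLogModulus_eq σ τ hτ]
  exact finite_support_capsulePacketLogModulus F A α f

/-- … and sum to zero over `𝕍_ℚ` (the product formula for `F_mod`). [claim: Mochizuki2012, status: disputed] -/
theorem finsum_relCapsulePacketLogModulus_eq_zero (α : A) (f : Fˣ) :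
    ∑ᶠ q, relCapsulePacketLogModulus σ τ A α f q = 0 := by
  rw [relCapsulePacketLogModulus_eq σ τ hτ]
  exact finsum_capsulePacketLogModulus_eq_zero F A α f

/-! ### The global log-volume `μ^log_{A,𝕍_ℚ}` and its invariance -/

/-- **"multiplication by elements of `(†𝕄⊛_mod)_α`" at the relative genuine `A`-packets**: `f ∈ F_mod^×` acts on a
global region through the label `α` at every `v_ℚ` and every portion; "zero log-volume for all but finitely many
`v_ℚ`" is preserved. [claim: Mochizuki2012, status: disputed] -/
def relCapsulePacketAction (α : A) (f : Fˣ) (S : GlobalRegion (relCapsulePacketLogVolume σ τ A)) :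
    GlobalRegion (relCapsulePacketLogVolume σ τ A) :=
  ⟨fun q π => (relPortionDatum σ τ A q π).actAdm α f (S.1 q π), by
    refine (S.2.union (finite_support_relCapsulePacketLogModulus σ τ hτ A α f)).subset fun q hq => ?_
    by_contra hq'
    rw [Set.mem_union, not_or, Function.notMem_support, Function.notMem_support] at hq'
    apply Function.mem_support.mp hq
    change relCapsulePacketLogVolume σ τ A q (fun π => (relPortionDatum σ τ A q π).actAdm α f (S.1 q π)) = 0
    rw [relCapsulePacketLogVolume_actAdm, hq'.1, hq'.2, add_zero]⟩

/-- Components of `f·_α S`. [claim: Mochizuki2012, status: disputed] -/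
@[simp] theorem relCapsulePacketAction_apply (α : A) (f : Fˣ) (S : GlobalRegion (relCapsulePacketLogVolume σ τ A))
    (q : RatPlace) (π : Portion F A q) :
    (relCapsulePacketAction σ τ hτ A α f S).1 q π = (relPortionDatum σ τ A q π).actAdm α f (S.1 q π) := rfl

/-- **IUTchIII:Prop3.9(iii)** (kurims p. 117) INVARIANCE CLAUSE AT THE RELATIVE GENUINE MODEL FOR EVERY CAPSULE `A`,
EVERY LABEL `α ∈ A`, EVERY `K ⊇ F_mod` AND EVERY SECTION OF PLACES (row REL39, part R3; node IUTchIII:Prop3.9(iii)):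
`Prop39iii_invariance (relCapsulePacketLogVolume σ τ A) (relCapsulePacketAction σ τ hτ A α)` HOLDS — "a global
log-volume `μ^log_{A,𝕍_ℚ}` … which is invariant with respect to multiplication by elements of `(†𝕄⊛_mod)_α`", for the
printed `A`-packets `⊕_{(v_α)} ⊗_α K_{v̲_α}` with their Haar log-volumes and the weights of Remark 3.1.1 (ii):
abc-iut-L6-t5's `Prop39iii_invariance_of_productFormula` fed with the local law and the product formula for `F_mod`
(the factors `[K_{v̲_α}:(F_mod)_{v_α}]` having cancelled, `relPortionDatum_shift`). [claim: Mochizuki2012, status: disputed] -/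
theorem prop39iii_invariance_haarModelRelCapsules (α : A) :
    Prop39iii_invariance (relCapsulePacketLogVolume σ τ A) (relCapsulePacketAction σ τ hτ A α) :=
  Prop39iii_invariance_of_productFormula (relCapsulePacketLogVolume σ τ A) (relCapsulePacketAction σ τ hτ A α)
    (relCapsulePacketLogModulus σ τ A α) (finite_support_relCapsulePacketLogModulus σ τ hτ A α)
    (finsum_relCapsulePacketLogModulus_eq_zero σ τ hτ A α)
    (fun f S q => relCapsulePacketLogVolume_actAdm σ τ A α f q (S.1 q))

/-- The invariance unfolded: `μ^log_{A,𝕍_ℚ}(f·_α S) = μ^log_{A,𝕍_ℚ}(S)`. [claim: Mochizuki2012, status: disputed] -/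
theorem globalLogVolume_relCapsulePacketAction (α : A) (f : Fˣ) (S : GlobalRegion (relCapsulePacketLogVolume σ τ A)) :
    globalLogVolume (relCapsulePacketLogVolume σ τ A) (relCapsulePacketAction σ τ hτ A α f S) =
      globalLogVolume (relCapsulePacketLogVolume σ τ A) S :=
  prop39iii_invariance_haarModelRelCapsules σ τ hτ A α f S

/-- **Nonarchimedean packet-normalisation at the relative `A`-packets** ([IUTchIII] Prop. 3.9 (i) p. 115): multiplying
every portion of a region at `p` by `p` placed in the factor `α` changes `μ^log_{A,p}` by exactly `−log p`
(d3's `packetLogModulus_prime_self`). [claim: Mochizuki2012, status: disputed] -/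
theorem relCapsulePacketLogVolume_prime_natCast (p : Nat.Primes) (α : A)
    (T : ∀ π : Portion F A (RatPlace.prime p), (relPortionDatum σ τ A (RatPlace.prime p) π).Adm) :
    relCapsulePacketLogVolume σ τ A (RatPlace.prime p)
        (fun π => (relPortionDatum σ τ A (RatPlace.prime p) π).actAdm α
          (Units.mk0 ((p : ℕ) : F) (by exact_mod_cast p.2.ne_zero)) (T π)) =
      relCapsulePacketLogVolume σ τ A (RatPlace.prime p) T - Real.log p := by
  rw [relCapsulePacketLogVolume_actAdm, relCapsulePacketLogModulus_eq_packetLogModulus σ τ hτ,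
    packetLogModulus_prime_self, sub_eq_add_neg]

omit σ τ hτ in
/-- Relative models exist for every `K ⊇ F_mod`: sections of the finite and of the archimedean places exist
(campaign-S `PlaceSection.nonempty`, Mathlib `InfinitePlace.comap_surjective`), so for every finite nonempty `A` and
every label the invariance clause is witnessed by a genuine relative model. [claim: Mochizuki2012, status: disputed] -/
theorem exists_prop39iii_invariance_haarModelRelCapsules (α : A) :
    ∃ (σ : PlaceSection F K) (τ : InfinitePlace F → InfinitePlace K) (hτ : ∀ w, (τ w).comap (algebraMap F K) = w),
      Prop39iii_invariance (relCapsulePacketLogVolume σ τ A) (relCapsulePacketAction σ τ hτ A α) := by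
  obtain ⟨σ'⟩ := PlaceSection.nonempty F K
  refine ⟨σ', fun w => (InfinitePlace.comap_surjective (K := K) w).choose,
    fun w => (InfinitePlace.comap_surjective (K := K) w).choose_spec, ?_⟩
  exact prop39iii_invariance_haarModelRelCapsules σ' _
    (fun w => (InfinitePlace.comap_surjective (K := K) w).choose_spec) A α

end Literature.IUT.LogThetaLattice

end
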